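import Mathlib

/-!
# The Picard number of the exact sextic's K3 is nineteen — arithmetic of the certificate (venture index file)

W3 «special fibres», w3-prym-2 g21, note `W3-RHO19-w3prym2.md` §2 (THEOREM R).  Honest framing: this file
records the ELEMENTARY ARITHMETIC behind the certificate that the minimal resolution `Ỹ₀′` of the exact
sextic double plane (`X0SexticFrame`) has geometric Picard number 19 and not 20.  The point counts
`s_p` (the character sums of the sextic over `𝔽_p`) enter as DATA (the table `spData`, established by two
independent counting codes of the lineage); what the kernel checks is: for each of the eight imaginary
quadratic fields `ℚ(√−d)`, `d ∈ {1, 2, 3, 6, 7, 14, 21, 42}` (the fields unramified outside `{2, 3, 7}`, the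
only possible CM fields of a rank-two transcendental lattice here), the listed witness prime `p` is INERT in
`ℚ(√−d)` (Euler's criterion) and the recorded `s_p` is neither `p` nor `−p` — whereas Picard number 20 would
force `s_p = ± p` at every inert prime.  Nothing here is a statement about the Hodge conjecture; no
`Literature` fact is introduced; the geometric input (the sextic, the counts) is cited, not formalised.
-/

namespace Summit.Ventures.HSemireg.X0SexticPicardNineteen

/-- The data: pairs `(p, s_p)` for the witness primes, from the lineage's two point-counting codes
(`prym2/g19/k3count/spcount.c`, `prym2/g21/rho19/rho19cert.py`): `s₁₁ = −1`, `s₁₇ = −31`, `s₂₃ = 11`, `s₂₉ = 7`. -/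
def spData : List (ℕ × ℤ) := [(11, -1), (17, -31), (23, 11), (29, 7)]

/-- The certificate rows: `(d, p)` = (CM discriminant parameter, witness prime). -/
def certRows : List (ℕ × ℕ) :=
  [(1, 11), (2, 23), (3, 11), (6, 17), (7, 17), (14, 11), (21, 29), (42, 11)]

/-- Euler's criterion value: `(-d)^((p-1)/2)` computed in `ZMod p`, returned as a natural number
representative (so `p - 1` encodes `−1`). -/
def eulerVal (d p : ℕ) : ℕ := ((((-(d : ℤ)) : ZMod p) ^ ((p - 1) / 2)) : ZMod p).val

/-- Every witness prime is inert in its field: `(-d)^((p-1)/2) ≡ -1 (mod p)` for all eight rows. -/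
theorem all_inert : certRows.all (fun r => eulerVal r.1 r.2 == r.2 - 1) = true := by decide

/-- The recorded value `s_p` at a prime `p` (0 if absent). -/
def sp (p : ℕ) : ℤ := ((spData.find? (fun q => q.1 == p)).map Prod.snd).getD 0

/-- At every witness prime the count is neither `p` nor `−p`. -/
theorem sp_ne_pm : certRows.all (fun r => (sp r.2 != (r.2 : ℤ)) && (sp r.2 != -(r.2 : ℤ))) = true := by
  decide

/-- The eight fields are exactly the imaginary quadratic fields unramified outside `{2,3,7}`: their
parameters are the squarefree divisors of `42 = 2·3·7`, i.e. ALL eight divisors of `42`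
(checked as: for every `d ≤ 42`, `d` is a listed parameter iff `0 < d` and `d ∣ 42`; all parameters are `≤ 42`). -/
theorem certRows_fields :
    ((List.range 43).all
        (fun d => ((certRows.map Prod.fst).contains d) == (decide (0 < d) && (42 % d == 0)))) = true ∧
      (certRows.map Prod.fst).all (· ≤ 42) = true := by
  decide

/-- Row-by-row form of the certificate (for citation): each row is inert with `s_p ∉ {p, -p}`. -/
theorem certificate :
    ∀ r ∈ certRows, eulerVal r.1 r.2 = r.2 - 1 ∧ sp r.2 ≠ r.2 ∧ sp r.2 ≠ -(r.2 : ℤ) := by decide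

end Summit.Ventures.HSemireg.X0SexticPicardNineteen
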